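import Mathlib.FieldTheory.Galois.Infinite
import Mathlib.FieldTheory.IsAlgClosed.AlgebraicClosure
import Mathlib.FieldTheory.Perfect
import Mathlib.Algebra.MvPolynomial.PDeriv
import Mathlib.Algebra.MvPolynomial.Nilpotent
import Mathlib.RingTheory.Polynomial.UniqueFactorization
import Literature.NumberTheory.DiophantineGeometry.CafureMatera
import HarnessLib

/-!
# An irreducible hypersurface with a nonsingular rational point is absolutely irreducible

Topic `Literature/NumberTheory/DiophantineGeometry`.  For a PERFECT field `K` and an irreducible
polynomial `f ∈ K[X₁, …, Xₙ]` having a `K`-rational zero `a` with `∂f/∂Xᵢ(a) ≠ 0` for some `i`,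
the polynomial `f` is absolutely irreducible (irreducible over an algebraic closure of `K`), in
the sense `Literature.NumberTheory.DiophantineGeometry.IsAbsIrreducible` of `CafureMatera.lean`:
`IsAbsIrreducible.of_irreducible_of_eval_pderiv_ne_zero`.

This is the classical remark that a `K`-irreducible hypersurface with a simple `K`-rational
point is geometrically irreducible (equivalently: on a hypersurface that is irreducible over `K`
but reducible over `K̄`, every `K`-rational point is singular).  The finite-field case in two
variables, by Frobenius descent, is `PlaneShear.irreducible_map_of_nonsingular`
(`PlaneCurveNonsingularPointProofs.lean`); the present file gives the general perfect-field case
by Galois descent.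

## Proof

Let `L = K̄`, `fᴸ` the image of `f`, `aᴸ` that of `a`.  An irreducible factor `g` of `fᴸ` vanishes
at `aᴸ`; write `fᴸ = g h`.  Since `∂ᵢfᴸ(aᴸ) = ∂ᵢg(aᴸ) h(aᴸ) ≠ 0`, `h(aᴸ) ≠ 0`, so every irreducible
factor of `fᴸ` vanishing at `aᴸ` is associated with `g` (primality in the factorial ring
`L[X]`).  For a `K`-automorphism `τ` of `L`, `τg` is such a factor (`τfᴸ = fᴸ`, `τaᴸ = aᴸ`), hence
`τg ∼ g`; after normalising one coefficient of `g` to `1` this forces `τg = g`, and then also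
`τh = h` (cancel `g` in `τfᴸ = fᴸ`).  As `L/K` is Galois for `K` perfect, the coefficients of `g`
and `h` lie in `K` (Mathlib `InfiniteGalois.mem_range_algebraMap_iff_fixed`): `g = g₀ᴸ`,
`h = h₀ᴸ`, `f = g₀ h₀`.  Irreducibility of `f` over `K` makes `h₀` a unit, so `fᴸ ∼ g` is
irreducible.

## Main declarations (all proved; no definitions, no named facts)

* `exists_map_algebraMap_eq_of_forall_map_algEquiv_eq` — a polynomial over a Galois extension
  `L/K` fixed coefficientwise by `Gal(L/K)` comes from `K`;
* `isGalois_algebraicClosure_of_perfectField` — `K̄/K` is Galois for `K` perfect;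
* `IsAbsIrreducible.of_irreducible_of_eval_pderiv_ne_zero` — the theorem of the title.
-/

noncomputable section

open MvPolynomial

namespace Literature.NumberTheory.DiophantineGeometry

section GaloisDescent

variable {K L : Type*} [Field K] [Field L] [Algebra K L] {σ : Type*}

/-- **Galois descent for polynomials.** Over a Galois extension `L/K` (possibly infinite), a
polynomial `p ∈ L[X_σ]` with `τp = p` (coefficientwise action) for every `K`-automorphism `τ` of
`L` is the image of a polynomial over `K`. [folklore] -/
theorem exists_map_algebraMap_eq_of_forall_map_algEquiv_eq [IsGalois K L] (p : MvPolynomial σ L)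
    (hp : ∀ τ : L ≃ₐ[K] L, MvPolynomial.map (τ : L →+* L) p = p) :
    ∃ p₀ : MvPolynomial σ K, MvPolynomial.map (algebraMap K L) p₀ = p := by
  classical
  have hcoeff : ∀ e, ∃ c : K, algebraMap K L c = p.coeff e := fun e => by
    have hfix : ∀ τ : L ≃ₐ[K] L, τ (p.coeff e) = p.coeff e := fun τ => by
      conv_rhs => rw [← hp τ]
      rw [MvPolynomial.coeff_map]; rfl
    obtain ⟨c, hc⟩ := (InfiniteGalois.mem_range_algebraMap_iff_fixed (p.coeff e)).mpr hfix
    exact ⟨c, hc⟩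
  choose c hc using hcoeff
  refine ⟨∑ e ∈ p.support, monomial e (c e), ?_⟩
  rw [map_sum]
  simp_rw [map_monomial, hc]
  exact (MvPolynomial.as_sum p).symm

/-- The algebraic closure of a perfect field is a Galois extension (normal, and separable
because algebraic extensions of perfect fields are separable). [folklore] -/
theorem isGalois_algebraicClosure_of_perfectField (K : Type*) [Field K] [PerfectField K] :
    IsGalois K (AlgebraicClosure K) :=
  isGalois_iff.mpr ⟨inferInstance, inferInstance⟩

end GaloisDescent

/-- **An irreducible polynomial over a perfect field with a nonsingular rational zero is
absolutely irreducible.** For `K` perfect, `f ∈ K[X₁, …, Xₙ]` irreducible, `a ∈ Kⁿ` with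
`f(a) = 0` and `∂f/∂Xᵢ(a) ≠ 0`, the image of `f` in `K̄[X₁, …, Xₙ]` is irreducible
(`IsAbsIrreducible f`). Equivalently: if `f` is irreducible over `K` but not absolutely
irreducible, all `K`-rational zeros of `f` are singular. Proof in the module docstring (Galois
descent of the irreducible factor through `a`). [folklore] -/
theorem IsAbsIrreducible.of_irreducible_of_eval_pderiv_ne_zero {K : Type*} [Field K]
    [PerfectField K] {n : ℕ} {f : MvPolynomial (Fin n) K} (hf : Irreducible f)
    {a : Fin n → K} (ha : eval a f = 0) (i : Fin n) (hna : eval a (pderiv i f) ≠ 0) :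
    IsAbsIrreducible f := by
  classical
  haveI : IsGalois K (AlgebraicClosure K) := isGalois_algebraicClosure_of_perfectField K
  set L := AlgebraicClosure K
  set ι : K →+* L := algebraMap K L with hι
  set fL : MvPolynomial (Fin n) L := MvPolynomial.map ι f with hfL
  set aL : Fin n → L := fun j => ι (a j) with haL
  change Irreducible fL
  -- evaluation at the rational point commutes with `map` and with the Galois action
  have heval : ∀ p : MvPolynomial (Fin n) K, eval aL (MvPolynomial.map ι p) = ι (eval a p) := by
    intro p
    rw [MvPolynomial.eval_map]
    change eval₂ ι aL p = ι (eval₂ (RingHom.id K) a p)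
    rw [MvPolynomial.eval₂_comp_left, RingHom.comp_id]
    rfl
  have hevalτ : ∀ (τ : L ≃ₐ[K] L) (p : MvPolynomial (Fin n) L),
      eval aL (MvPolynomial.map (τ : L →+* L) p) = τ (eval aL p) := by
    intro τ p
    rw [MvPolynomial.eval_map]
    change eval₂ (τ : L →+* L) aL p = (τ : L →+* L) (eval₂ (RingHom.id L) aL p)
    rw [MvPolynomial.eval₂_comp_left, RingHom.comp_id]
    congr 1
    funext j
    simp only [Function.comp_apply, haL]
    exact (τ.commutes (a j)).symm
  have hmapτ : ∀ τ : L ≃ₐ[K] L, MvPolynomial.map (τ : L →+* L) fL = fL := fun τ => by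
    have hc : (τ : L →+* L).comp ι = ι := RingHom.ext fun c => τ.commutes c
    rw [hfL, MvPolynomial.map_map, hc]
  have hfL0 : fL ≠ 0 := by
    rw [hfL]
    intro h0
    exact hf.ne_zero (MvPolynomial.map_injective ι ι.injective (by rw [h0, map_zero]))
  have hfLa : eval aL fL = 0 := by rw [hfL, heval, ha, map_zero]
  have hdfLa : eval aL (pderiv i fL) ≠ 0 := by
    rw [hfL, pderiv_map, heval]; exact (map_ne_zero ι).mpr hna
  -- an irreducible factor `g` of `fL` through `aL`
  obtain ⟨s, hsirr, u, hsu⟩ := WfDvdMonoid.exists_factors fL hfL0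
  have hprod0 : (s.map (eval aL)).prod = 0 := by
    rw [← map_multiset_prod]
    have h := congrArg (eval aL) hsu
    rw [map_mul, hfLa] at h
    rcases mul_eq_zero.mp h with h | h
    · exact h
    · exfalso
      obtain ⟨r, hr, hreq⟩ := MvPolynomial.isUnit_iff_eq_C_of_isReduced.mp u.isUnit
      rw [hreq, eval_C] at h
      exact hr.ne_zero h
  obtain ⟨g, hgs, hga⟩ : ∃ g ∈ s, eval aL g = 0 := by
    have h0 := Multiset.prod_eq_zero_iff.mp hprod0
    simpa using h0
  have hg_irr : Irreducible g := hsirr g hgs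
  have hg_dvd : g ∣ fL := (Multiset.dvd_prod hgs).trans (Dvd.intro _ hsu)
  obtain ⟨h, hgh⟩ := hg_dvd
  -- `h(aL) ≠ 0` by nonsingularity
  have hha : eval aL h ≠ 0 := by
    intro hh0
    apply hdfLa
    rw [hgh, Derivation.leibniz, map_add, smul_eq_mul, smul_eq_mul, map_mul, map_mul, hga, hh0,
      zero_mul, zero_mul, add_zero]
  -- every irreducible factor of `fL` through `aL` is associated to `g`
  have hassoc : ∀ q : MvPolynomial (Fin n) L, Irreducible q → q ∣ fL → eval aL q = 0 →
      Associated q g := by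
    intro q hq hqdvd hqa
    have hqprime : Prime q := hq.prime
    rw [hgh] at hqdvd
    rcases hqprime.dvd_or_dvd hqdvd with hqg | hqh
    · exact hq.associated_of_dvd hg_irr hqg
    · exfalso
      obtain ⟨t, ht⟩ := hqh
      apply hha
      rw [ht, map_mul, hqa, zero_mul]
  -- normalise a coefficient of `g` to `1`
  obtain ⟨e₀, he₀⟩ := MvPolynomial.ne_zero_iff.mp hg_irr.ne_zero
  set cst : L := g.coeff e₀ with hcst
  set g₁ : MvPolynomial (Fin n) L := C cst⁻¹ * g with hg₁
  set h₁ : MvPolynomial (Fin n) L := C cst * h with hh₁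
  have hfL₁ : fL = g₁ * h₁ := by
    rw [hgh, hg₁, hh₁]
    have : (C cst⁻¹ : MvPolynomial (Fin n) L) * C cst = 1 := by
      rw [← C_mul, inv_mul_cancel₀ he₀, C_1]
    linear_combination (-(g * h)) * this
  have hg₁e₀ : g₁.coeff e₀ = 1 := by
    rw [hg₁, MvPolynomial.coeff_C_mul, ← hcst, inv_mul_cancel₀ he₀]
  have hCunit : IsUnit (C cst⁻¹ : MvPolynomial (Fin n) L) :=
    (isUnit_iff_ne_zero.mpr (inv_ne_zero he₀)).map C
  have hg₁_irr : Irreducible g₁ := by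
    rw [hg₁]; exact (irreducible_isUnit_mul hCunit).mpr hg_irr
  have hg₁a : eval aL g₁ = 0 := by rw [hg₁, map_mul, hga, mul_zero]
  have hg₁_dvd : g₁ ∣ fL := Dvd.intro _ hfL₁.symm
  -- `g₁` is Galois-invariant
  have hg₁τ : ∀ τ : L ≃ₐ[K] L, MvPolynomial.map (τ : L →+* L) g₁ = g₁ := by
    intro τ
    have hirrτ : Irreducible (MvPolynomial.map (τ : L →+* L) g₁) :=
      hg₁_irr.map (MvPolynomial.mapEquiv (Fin n) (τ : L ≃+* L))
    have hdvdτ : MvPolynomial.map (τ : L →+* L) g₁ ∣ fL := by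
      rw [← hmapτ τ]; exact map_dvd _ hg₁_dvd
    have haτ : eval aL (MvPolynomial.map (τ : L →+* L) g₁) = 0 := by
      rw [hevalτ, hg₁a, map_zero]
    have hA : Associated (MvPolynomial.map (τ : L →+* L) g₁) g₁ :=
      (hassoc _ hirrτ hdvdτ haτ).trans (hassoc _ hg₁_irr hg₁_dvd hg₁a).symm
    obtain ⟨v, hv⟩ := hA
    obtain ⟨r, hr, hreq⟩ := MvPolynomial.isUnit_iff_eq_C_of_isReduced.mp v.isUnit
    rw [hreq, mul_comm] at hv
    have hcoef := congrArg (MvPolynomial.coeff e₀) hv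
    rw [MvPolynomial.coeff_C_mul, MvPolynomial.coeff_map, hg₁e₀] at hcoef
    have hr1 : r = 1 := by
      have : r * ((τ : L →+* L) 1) = 1 := hcoef
      rwa [map_one, mul_one] at this
    rw [hr1, C_1, one_mul] at hv
    exact hv
  obtain ⟨g₀, hg₀⟩ := exists_map_algebraMap_eq_of_forall_map_algEquiv_eq g₁ hg₁τ
  -- hence so is `h₁`
  have hg₁0 : g₁ ≠ 0 := hg₁_irr.ne_zero
  have hh₁τ : ∀ τ : L ≃ₐ[K] L, MvPolynomial.map (τ : L →+* L) h₁ = h₁ := by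
    intro τ
    have h := hmapτ τ
    rw [hfL₁, map_mul, hg₁τ] at h
    exact mul_left_cancel₀ hg₁0 h
  obtain ⟨h₀, hh₀⟩ := exists_map_algebraMap_eq_of_forall_map_algEquiv_eq h₁ hh₁τ
  -- descend the factorisation and conclude
  have hfact : f = g₀ * h₀ := by
    apply MvPolynomial.map_injective ι ι.injective
    rw [map_mul, hg₀, hh₀, ← hfL₁]
  rcases hf.isUnit_or_isUnit hfact with hu | hu
  · exfalso
    apply hg₁_irr.not_isUnit
    rw [← hg₀]; exact hu.map _
  · rw [hfL₁]
    refine (irreducible_mul_isUnit ?_).mpr hg₁_irr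
    rw [← hh₀]; exact hu.map _

/-- Contrapositive form used for counting: if `f` is irreducible over the perfect field `K` but
NOT absolutely irreducible, then every `K`-rational zero of `f` is a singular point (all first
partial derivatives vanish there). [folklore] -/
theorem eval_pderiv_eq_zero_of_irreducible_of_not_isAbsIrreducible {K : Type*} [Field K]
    [PerfectField K] {n : ℕ} {f : MvPolynomial (Fin n) K} (hf : Irreducible f)
    (hnabs : ¬ IsAbsIrreducible f) {a : Fin n → K} (ha : eval a f = 0) (i : Fin n) :
    eval a (pderiv i f) = 0 := by
  by_contra hna
  exact hnabs (IsAbsIrreducible.of_irreducible_of_eval_pderiv_ne_zero hf ha i hna)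

end Literature.NumberTheory.DiophantineGeometry

end
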